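import Summits.ValiantsHypothesis.ValiantsHypothesis.Theses.BorderApolarity
import Summits.ValiantsHypothesis.ValiantsHypothesis.Theorems.ToricFixedPoints.Negative.WithoutOrbitFalse
import Summits.ValiantsHypothesis.ValiantsHypothesis.Theorems.ToricFixedPoints.Negative.WithoutLowerLimitFalse
import Summits.ValiantsHypothesis.ValiantsHypothesis.Theorems.ToricFixedPoints.Negative.WithoutUpperLimitFalse
import Summits.ValiantsHypothesis.ValiantsHypothesis.Theorems.BorderApolarityFixedWitnessObstructionQPAnnSubmodule
import Summits.ValiantsHypothesis.ValiantsHypothesis.Theorems.BorderApolarityFixedWitnessObstructionQPKuratowskiSubmodule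
import Summits.ValiantsHypothesis.ValiantsHypothesis.Theorems.BorderApolarityToricFixedPointsToricLimitIsInitialAux1
import Summits.ValiantsHypothesis.ValiantsHypothesis.Theorems.BorderApolarityToricFixedPointsToricLimitIsInitial
import Summits.ValiantsHypothesis.ValiantsHypothesis.Theorems.BorderApolarityToricFixedPointsCellApproachableAux1
import Literature.Computability.AlgebraicComplexity.Apolarity
import Literature.Computability.AlgebraicComplexity.ApolarityAction
import Literature.Computability.AlgebraicComplexity.ApolarityTopPairing
import Literature.Computability.AlgebraicComplexity.DeterminantIrreducible

/-!
# Disproof work file — crux `ToricFixedPoints` (stmt-ValiantsHypothesis-5779), refuter cdisprove gen 3 (cycle 3)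

Crux (route `BorderApolarity`, rank 3): for `3 ≤ n ≤ m`, every `H₀(n,m)`-stable Kuratowski limit
`J = K-lim_t Ann(P_t)` (`P_t ∈ GL_{m²}·det_m`) equals `K-lim_t Ann(u·diag((t+2)^w)·g·det_m)` for some
`u, g ∈ GL_{m²}`, `w : m×m → ℤ`.

## Findings (index; details in the docstrings of each section)

* §0 `constantCase` (positive, evidence only): constant sequences `P_t = P_0` satisfy the conclusion
  with `u = 1`, `w = 0` — interior points are toric.  (Re-proved here; gen-1's file is not mounted on
  this hub.)
* §1 `toricFixedPoints_false_without_orbit` — LANDED (gen 1, p70156,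
  `Theorems/ToricFixedPoints/Negative/WithoutOrbitFalse.lean`, imported): the orbit hypothesis is
  load-bearing (`P_t = 0`, `J = everything`).
* §2 `toricFixedPoints_false_without_lowerLimit` — LANDED (gen 2, p73812,
  `Theorems/ToricFixedPoints/Negative/WithoutLowerLimitFalse.lean`, imported; statement recalled below): the clause (Li) "`J_k ⊆ lim inf
  Ann_k(P_t)`" is load-bearing — without it `P_t = det_m`, `J_k = {all degree-k forms}` satisfies every
  remaining hypothesis and the conclusion fails in degree `0` (`Ann_0(Q_t) = 0` because translates of
  `det_m` are non-zero).  Moral: provers must use (Li) to bound `J_k` from ABOVE by the Hilbert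
  function of `det_m^⊥`.
* §3 `toricFixedPoints_false_without_upperLimit` — LANDED (gen 2, p73827,
  `Theorems/ToricFixedPoints/Negative/WithoutUpperLimitFalse.lean`, imported): the clause (Ls) "`lim sup ⊆ J_k`" is
  load-bearing — without it `P_t = det_m`, `J_k = {0}` satisfies every remaining hypothesis, while the
  conclusion forces `dim J_m = dim Ann_m(det_m) = C(m²+m-1, m) - 1 > 0` (closedness of the Grassmannian:
  `stub_kuratowskiSubmodule` + `stub_annSubmodule` of the sister crux).  Moral: (Ls) is what pins the
  DIMENSION of `J_k` from below; any proof must use both halves of the Kuratowski limit.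
* §4 (comments; computations in `comp/` of the unit folder, exact arithmetic over ℚ) — the (3,3)
  campaign of cycle 2 (unpadded case `n = m = 3`, where `H₀ = T = {diag(a_i b_j) : Π a_i b_i = 1}`):
  (a) REDUCTION (u = 1): for an `H₀`-fixed `J` the conclusion holds iff `J = in_w(Ann(det_m(Ax)))` for a
      DIAGONAL weight `w ∈ ℤ^{m²}` and some `A ∈ GL_{m²}` (the padding torus `T̃_H` contains regular
      semisimple elements, so every maximal torus of `Stab(J)°` through it is diagonal; conjugate the
      1-PSG inside `Stab(J)°`; triage r1-2 R1).  Dually a point is `y = (M_2, F)`, `M_2 = J_2^⊥ ⊇ ∂F` the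
      limit of the spans of `2×2` minors, `F` the limit form; toric ⇔ `M_2 = in_w(minors of Ax)` and
      `F = in_w(det(Ax))` (top-weight initial subspaces).
  (b) REFUTATION CRITERION (no fixed point needed): if a `T`-weight form `F ∈ Det_m` carries no toric
      `H₀`-fixed point while (Borel) the `H₀`-stable projective fibre of `Z_det → Det_m` over `[F]` is
      non-empty, the crux is false.  At (3,3) the FORM level is clean: every `T`-weight cubic in
      `End(ℂ⁹)·det_3` is a diagonal initial form (essential-variable argument: `U_F` is `T`-stable hence a
      coordinate space, so any size-3 representation restricts to `span(x_S)` spanning it and extends to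
      an invertible substitution with `w = -1` off `S`), and NO `T`-weight form lies in the open orbit
      `GL_9·P_Λ` of the second boundary component (its projective stabiliser has toral rank 4 <
      5 = rk(T·ℂ*); Landsberg 2017 §8.5.1).  So a (3,3) counterexample must live in a positive-dimensional
      fibre over a CONE form (`x_a³`, `x_a²x_b`, `x_ax_bx_c`, `T`-weight binomials, `D7`, `D8`).
  (c) FIBRES over `D8 = det_3|_{x₃₃=0}` and `D7 = det_3|_{x₁₁=x₂₂=0}`: enumerating all `T`-stable
      `M_2 ⊇ ∂F` with `dim S¹·M_2 ≤ 65 = dim S¹·𝔐_2` (closed condition, semicontinuity) leaves exactly 1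
      candidate over `D8` (the interior-type point, toric) and 14 over `D7`; all 14 have the full Segre
      Hilbert function `dim (M_2)_d = C(d+8,8) - C(d+2,2)²` for `d ≤ 6`; pencils `A₀ + tA₁ (+t²A₂)` and
      toric templates over `D7` only ever produce the obvious point `∂D7 ⊕ ⟨x₁₃x₃₁, x₂₃x₃₂⟩ =
      in_w(𝔐)`, `w = -1_{11,22}` (600+400 samples): no certified non-toric point, the other 13 are not
      known to lie in `Z_det`.
  (d) CENSUS of `T`-fixed points of `Z_det_3` modulo `W = (S₃×S₃)⋊ℤ/2` (`comp/db33.json`, 20 400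
      constructions): 9 488 distinct points (7 924 monomial, 1 564 containing one binomial
      `x_{ik}x_{jl} + c·x_{il}x_{jk}`), of which 5 589 are toric BY CONSTRUCTION (`in_μ(A𝔐)`, `μ` a generic
      rank-one cocharacter, `A` random/structured) and 3 899 were reached only by TWO-STEP constructions
      `in_μ(h·z)` (`z` a toric or pencil/Jordan-pencil limit, `h ∈ GL_9` random); the two-only points
      have the same invariants as the toric ones (dim S¹·M_2 ∈ [52,65] in both classes; 857 monomial
      points with the full Segre Hilbert function all pass the Kalkbrener–Sturmfels test — radical
      equidimensional of height 4 and connected in codimension 1 — and the BB-cell test `h(y) ≥ 34`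
      (below), with `h ∈ [44, 79]` in both classes); one two-only point over `x₁₁³` checked by hand IS
      toric (`L = x₁₁I + L'`, `x₃₃` confined to one off-diagonal entry).  The binomial points come in
      308 `ℙ¹`-families (largest: 788 members, `F = x₁₁³`, line `x₁₁x₂₂ + c·x₁₂x₂₁`) whose monomial
      end-points are toric-known.  VERDICT of the cycle: no counterexample at (3,3); the sampling
      comparison is inconclusive by nature (toric realisations of deep points need very special `A`).
  (e) TWO NEW NECESSARY CONDITIONS for toricity of a `T⁹`-fixed point `y` (usable as certificates):
      (KS) if `(M_2)` has the Segre Hilbert function then toric ⇒ `(M_2) = in_≺(A·I_Segre)` is the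
      initial ideal of a prime ⇒ equidimensional & connected in codim 1 (Kalkbrener–Sturmfels 1995);
      (CELL) toric via chamber `w` ⇒ the BB cell `O ∩ W⁺_w(y)` contains the Borel orbit `U(w)T⁹·(A𝔐)` of
      dimension ≥ 45 - 11 = 34 (a connected solvable subgroup of `Stab(A𝔐) ≅ G_det·ℂ*` has dim ≤ 11),
      so `dim(T_yỸ ∩ L_w) ≥ 34` where `Ỹ ⊇ Z_det` is any variety with computable tangent space at `y`
      (e.g. `{dim S¹·M ≤ 65} ∩ {dim S²·M ≤ 270}`, whose tangent space is `Hom_S(I,S/I)_0` computed with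
      first syzygies of degree ≤ 2) and `L_w` = negative-weight part: `h(y) := max_w Σ_{w·χ<0} mult(χ)
      ≥ 34`.  Neither fires at (3,3) on the census.
      (ROOTS) toric `y = in_w(A𝔐)` ⇒ `𝔤_y ⊇ K̂ = in_w(Ad(A)𝔨₀)`, a 17-dimensional `w`-graded Lie subalgebra
      (Adsul–Sohoni–Subrahmanyam 2023, Thm 1.1, `𝔨₀ = Lie Stab(𝔐) ≅ gl₃⊕gl₃/ℂ`), and `dim(K̂ ∩ 𝔱⁹) ≤ 5`
      (the weight-0 part of `K̂` is the image in `𝔟_w/𝔫_w` of the solvable algebraic `𝔨' ∩ 𝔟_w`, whose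
      maximal torus has dim ≤ rk 𝔨₀ = 5 and whose nilpotent part has zero diagonal); for a monomial `y`,
      `𝔤_y = 𝔱⁹ ⊕ ⨁_{(i,j)∈R_y} ℂ·x_i∂_j`, so toric ⇒ `|R_y| ≥ 12`.  On the census `|R_y| ∈ [16, 64]`
      (two-step-only points: ≥ 18) — no violation.

* §5 (comments) padded case (3,4) and two structural lemmas (proved on paper, used by the campaign; they
  are POSITIVE statements — provers may want them):
  (Z-ELIMINATION) Let `y` be an `H₀(n,m)`-fixed point over a `T̃_H`-weight form `F ∈ ℂ[ℓ,Y]_m` and suppose `y` is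
      entirely `z`-free (`M_k ⊂ ℂ[ℓ,Y]_k` for all `k`; at (3,4) over `[ℓ·det₃(Y)]` every `H₀`-fixed point found
      is of this kind, cf. triage r1-2 A3).  Then `y` is toric iff there is a 4×4 (in general m×m) matrix `L₀`
      of linear forms in the `n²+1` variables `ℓ, Y` ONLY and a weight `w' = (e; r_i + c_j)` with: the `k×k`
      minors of `L₀` linearly independent for every `k`, and `in_{w'}` of their spans equal to `M_k` for all `k`
      (proof: `u = 1` and `w ∈ X_*(D_y)`; if any `q ∈ A·𝔐_k` had a `z`-monomial on top, `in_w` would not be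
      `z`-free, so `q ↦ q|_{z=0}` is injective on `A·𝔐_k` and commutes with taking tops; conversely complete
      `L₀` by the `z`'s with very negative weights).  The padding variables disappear from the toricity
      question; what remains is a problem on `m×m` matrices over a `10`-dimensional space of forms with a
      RANK-ONE weight on `Y`.
  (TORUS FORCING, r1-3 F3 made quantitative) over `[ℓ^{m-n}det_n(Y)]` or `[ℓ^{m-n}per_n(Y)]` the diagonal
      stabiliser of any `H₀`-fixed `y` is exactly `T̃_H`, so the toric chamber is a `T̃_H`-cocharacter
      `(e; r_i+c_j; d_z)`.
  (3,4) CENSUS (`comp/gen34.py`, `gen34b.py`, `targ34.py`, db34*.json): over `[ℓ⁴]` 21 `H₀`-fixed points (20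
      toric by construction, 1 two-step), all with `M_3 = ℓ²·S¹`, `M_2 = ℓ·S¹ ⊕ R₂₀(Y)`; over `[ℓ·det₃(Y)]` the
      r1-2-style two-step generator (arc limit from `diag(ℓ,Y)+sB`, `u ∈ H₀^u`, `in_λ`) gives `H₀`-fixed points
      at rate 10/24, all `z`-free with `M_3 = ℓ·𝔐₂(Y) ⊕ ⟨det₃Y⟩ ⊕ ⟨6 products Y_{ab}·(2×2 minor of Y)⟩`; the
      structured toric family `L₀ = [[ℓ, α(Y)],[β(Y), Y]]` (monomial `α, β`, `e ≫ 0`, `z` light) is `H₀`-fixed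
      at rate 277/400 and REALISES the first two-step point exactly (targeted match of `M_4, M_3, M_2`); the
      next two match `M_4, M_3` within 60 random trials.  No certified non-toric point at (3,4) either.
  NUMERICS (3,3) (`comp/lmtoric.py`, Levenberg–Marquardt on the chart equations `c_{EF}(A) = 0` + Newton
      conditions on `det(Ax)`, 81 real unknowns): toric-known points are re-solved to residual < 1e-25
      (calibration 9/9); two-step-only points: in their generating chamber 4 solved / 2 near / 2 stuck, but the
      `barycentric' chamber `w = 30·Σ_{E∈M₂}E + 90·E₀` solves the stuck ones in seconds; batch at session end:
      57 of 57 resolved two-step-only points (incl. 31 Jordan-pencil-derived) are numerically TORIC (residual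
      < 1e-18), 0 near, 0 unresolved (runs lm3_*.log; kit batch j009797 queued, auto-attached).  (3,4): a
      second two-step `H₀`-fixed point over `[ℓ·det₃Y]` fully matched by `[[ℓ,α],[β,Y]]` (2/4 targets toric,
      the other 2 match `M_4, M_3` in 150 random trials).
  CYCLE-2 VERDICT: the crux RESISTS at (3,3) and (3,4): every `H₀`-fixed point that could be examined closely
      is toric, typically through a structured translate mirroring its construction (`x₁₁I + L''`,
      `[[ℓ,α],[β,Y]]`); the obstruction to a kill is the ∃A-quantifier (no certificate KS/CELL fires), the
      obstruction to a proof is the same quantifier from the other side (line bb-cell-state-polytope S2/S4).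

## CYCLE 3 (gen 3) — new findings

* §6 (NEW; docblock below + theorem `h0Stable_without_character`, sorry-free, proposed as
  `Theorems/ToricFixedPoints/Negative/CharacterNotLoadBearing.lean`): **FORM-LEVEL REDUCTION and TORIC
  DE-BORDERING.**  (6a) Clause (d) (character `= 1`) of `H₀` is NOT load-bearing: for Kuratowski limits
  W4 with (a)–(d) already gives stability under all invertible `M` with (a)–(c) (rescale `M ↦ cM`,
  `c^m χ(M) = 1`).  (6b) PAPER THEOREM (uses the `u = 1` reduction §4(a), valid for all `m ≥ n` because
  `T̃·ℂ*` — `ℓ ↦ eℓ`, `Y_ij ↦ a_ib_jY_ij`, `z_k ↦ d_kz_k` — contains regular semisimple elements): if the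
  crux holds then for EVERY `z`-free `T̃`-weight form `F ∈ Δ(det_m)` (equivalently `F = ℓ^a G(Y)`, `G` of
  fixed row/column content, padded border complexity `≤ m`) — each such `[F]` is `H₀`-fixed and its
  fibre in `Z_det` is a non-empty `H₀`-stable projective variety, so by Borel it CARRIES an `H₀`-fixed
  point (this is support item `BorelFixedBorderApolarity` with `pp` replaced by `F`) — one has
  `F = in_w^{top}(det_m(A x))` for some `A ∈ GL_{m²}` and DIAGONAL `w ∈ ℤ^{m²}`; setting `z = 0` (the
  `z`-free top part of `det(Ax)` is the top part of `det(Ax)|_{z=0}`, no rank condition needed) and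
  `ℓ = 1` (shift `w` so that `w(ℓ) = 0`):  **`G = in_ω(P)` with `dc(P) ≤ m`** (`P = det L₀(1,Y)`, an
  `m × m` determinant of affine-linear forms in the `n²` variables `Y`) and `ω ∈ ℤ^{n×n}` making `G`
  `ω`-homogeneous of top weight; for `G = per_n` (or any `G` whose support affinely spans the
  Birkhoff polytope) `ω` is forced RANK-ONE, `ω_ij = α_i + β_j`, i.e.
  `per_n(Y) = lim_s c·s^{-ν} P(diag(s^α)·Y·diag(s^β))`.  CONSEQUENCE ("toric de-bordering"):
  `ToricFixedPoints ∧ BorelFixedBorderApolarity ⇒ ∀ n ≥ 3, ∀ m: bdc(per_n) ≤ m → tdc(per_n) ≤ m`, where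
  `tdc(G) := min{m : G = in_ω(P), dc(P) ≤ m, ω rank-one}` (`bdc ≤ tdc ≤ dc` trivially).  So a proof
  of the crux turns EVERY border-determinantal expression of a permanent into a rank-one-TORUS limit of
  an honest determinantal expression of the same size — a de-bordering statement for Mulmuley–Sohoni's
  `Δ(det)` that is open and would be news on its own (Landsberg 2017 §6.7.3, Problem 6.5.2.4: no
  equation or structure theorem separating padded cones in `Δ(det_m)` from `End(W)·det_m` is known).
  Caveat recorded: `tdc` is NOT known to be polynomially related to `dc` (the weights `α, β` may be
  exponentially large, so interpolating the top `s`-power costs `2^{Õ(n)}` determinants).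
  (6c) FORM-LEVEL KILL CRITERION: the crux is refuted by any fixed-content `G` (on `n × n` variables,
  `n ≥ 3`) with `bdc_pad(G) ≤ m < tdc(G)`; End-type forms never qualify (`F = det L₀(ℓ,Y)` is its own
  initial form; its essential-variable space is a coordinate space because `F` is a weight vector, so
  `L₀` completes to a full-rank `L` by unused variables at low weight): a candidate must be a padded CONE
  in `Δ(det_m) ∖ End(W)·det_m` (LMR13 Prop 3.5.1: `End(W)·det_m = GL(W)·det_m ∪ cones`).  The printed
  boundary forms are all excluded as `T̃`-weight vectors by TORUS RANK / CONTENT PATTERN: `P_Λ`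
  (LMR13; Landsberg 2017 Prop 6.7.2.2) has projective stabiliser of toral rank 4 while the rank-one
  torus restricted to any 9 distinct positions has rank `≥ 5` (bipartite graph with 9 edges:
  `R + C - comp ≥ 5`); the ABV cone `Q = x₁³ + x₂²x₃ + x₂x₄²` (`dc(Q) ≥ 6`, Landsberg 2017 Thm 6.7.3.1, a
  degeneration of `P_Λ`, hence a cone in `Δ(det_3) ∖ End`) has stabiliser rank 2 `<` 3 `≤` rank on 4
  positions; `Σ_i s_i a_i²` (also in `cl(GL_9·P_Λ) ∖ End`, since it specialises to `Q`) has rank 4 but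
  content pattern `pos(s_i) + 2·pos(a_i) = const` forces all `a_i` to one position.  General lesson: a
  `T̃`-weight form is a sum over CONTINGENCY TABLES with common margins (immanant-like), and no
  immanant-like padded polynomial with `bdc < dc` is known — WHY THE CRUX RESISTS at the form level.
  (6d) (3,3) form level, completing gen-2 §4(b): the `T⁵`-weight cubics are the 6 content classes
  `x₁₁³, x₁₁²x₁₂, x₁₁x₁₂x₁₃, ⟨x₁₁²x₂₂, x₁₁x₁₂x₂₁⟩, ⟨x₁₁x₁₂x₂₃, x₁₁x₁₃x₂₂, x₁₂x₁₃x₂₁⟩, F_c = Σ_σ c_σ x_σ`;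
  the first five are in `End(ℂ⁹)·det_3` identically (explicit `3 × 3` determinants, e.g.
  `αx₁₁x₁₂x₂₃ + βx₁₁x₁₃x₂₂ + γx₁₂x₁₃x₂₁ = det[[x₁₁,x₁₂,0],[0,x₁₂,x₁₃],[γx₂₁,-βx₂₂,αx₂₃]]`); for `F_c`:
  `GL_9·det_3 ∩ {F_c} = {c ∈ (ℂ*)⁶ : c_id c_(123) c_(132) + c_(12) c_(13) c_(23) = 0}` (torus rescalings
  composed with `N(T⁵) = T⁹ ⋊ (S₃ × S₃ ⋊ ℤ/2)`), no CONCISE `F_c` with a zero coefficient lies on that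
  hypersurface's closure pattern (a vanishing 3-cycle coefficient kills conciseness unless all
  transposition coefficients are non-zero, and conversely), and e.g. `(det_3 + per_3)/2 = Σ_k Π_i y_ik`
  (broken diagonals) is NOT in `Δ(det_3)`: its dual variety is a hypersurface (Gauss map generically
  finite), of dimension `7 > 4 = 2·3 - 2` (LMR13 degenerate-dual criterion).  So concise `T⁵`-weight
  boundary forms do not exist at (3,3); every (3,3) fixed point lies over a cone form (as gen 2 found).
* §7 (NEW; sorry-free theorems `toricFixedPointsInterior_false_of_S1` and — S1 having LANDED at 02:39Z
  (`stub_toricLimitIsInitial`) — the UNCONDITIONAL `toricFixedPointsInterior_false`, proposed as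
  `Theorems/ToricFixedPoints/Negative/InteriorFalse.lean`): the INTERIOR strengthening of the crux
  (conclusion with `w = 0`, `u = 1`: "`J = Ann(g·det_m)`") is FALSE: witness the `T`-fixed limit of the toric curve
  `diag((t+2)^{wDiag})·det_3`, `wDiag` = indicator of the diagonal (limit form `x₀₀x₁₁x₂₂`); W4 holds
  because each `P_t` is a `T`-weight vector (`linSubst_diagonal_detPoly`) and limits of `T`-stable
  spaces are `T`-stable; `J_3 ∋ ∂^e` for all `e ≠ e_id` (`monomial_mem_inSpan_three`); an interior `J`
  would force `g·det_3 ∝ x₀₀x₁₁x₂₂`, contradicting `dim Ann_1(g·det_3) = 0`.  This is the first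
  Lean-available BOUNDARY `H₀`-fixed point of `Z_det` (usable by other seats to test stubs).
  Paper-level companion (not formalised: its `W4` needs the explicit `J_2`): the `g = 1` strengthening
  ("`J = u·in_w(Ann det_m)`, a translate of a Gröbner degeneration of `det_m` ITSELF") is also false —
  every `T⁹`-initial form of `det_3` is a face polynomial `det(x_Γ)`, multilinear, hence never
  `GL_9`-equivalent to `x₀₀³`; but `x₀₀³ ∈ End·det_3` is a `T⁵`-weight form, so (Borel) it carries a
  `T⁵`-fixed point, realised torically e.g. by `L = x₀₀·I + N` (`N` = the other 8 variables, `N₀₀ = 0`),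
  `w = 1_{x₀₀}`: there `in_w(M_2(L)) = x₀₀·W` (adj`(sI+N) = s²I + s(tr N·I - N) + adj N`), so the point is
  even `T⁹`-fixed.  Moral: the translate `g` in the conclusion is essential; the fixed-point set is NOT a
  finite union of `GL`-orbits of Gröbner degenerations of `det_m`.
* Side conditions (paper): dropping `3 ≤ n` / `n ≤ m` exposes only `(n,m) ∈ {(1,1),(1,2),(2,2),(3,2),…}`
  where the conclusion HOLDS (at (2,2): `Δ(det_2)` = all quadrics, `T³`-weight quadrics
  `x₁₁², x₁₁x₁₂, αx₁₁x₂₂+βx₁₂x₂₁` are all diagonal initial forms of non-degenerate quadrics) — no cheap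
  counterexample; `3 ≤ n` is not visibly load-bearing.
* CYCLE-3 VERDICT: no kill.  The crux now reads, at the form level, as a toric de-bordering principle for
  immanant-like padded polynomials; refuting it there needs an explicit `bdc < tdc` gap (open), and
  refuting it in a fibre needs a certificate of non-toricity against the `∃A ∈ GL_{m²}` quantifier
  (gen-2 certificates KS/CELL/ROOTS never fire).  What a PROOF must do is correspondingly strong.
  NEXT FORM-LEVEL TARGET (cycle 4): `G₃ := x₁₁x₂₂x₃₃ + x₁₂x₂₃x₃₁ + x₁₃x₂₁x₃₂` (`T⁵`-weight, cyclic):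
  exact computation (`comp/g3_local.py`, rational points of `Z(G₃)`): Hessian rank 9 on `Z(G₃)` ⇒
  `dc(G₃) ≥ 5` (Mignon–Ressayre), dual variety of dimension 7 ⇒ `bdc_pad(G₃) ≥ 5` (LMR13:
  `2m - 2 ≥ 7`), and `dc(G₃) ≤ 7` (width-3 ABP).  If `ℓ²G₃ ∈ Δ(det_5)` (an explicit size-5 border
  expression) while `tdc(G₃) > 5` (no `5 × 5` affine `P` with `in_ω(P) = G₃`), the crux is dead by (6b).
  PARTIAL RESULT (paper, cycle 3): for the two degree-extremal chamber families `ω = ∓N·𝟙 + ε` ("`G₃` is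
  the `ε`-top of the LOWEST / HIGHEST `Y`-degree part of `P = det(C + L₁(Y))`") the lowest-degree case
  is IMPOSSIBLE at size 5: with `C` of corank `r`, `r = 3` gives `G₃ = in_ε(det L₁[K,K]) ∈ Δ(det_3)`
  (excluded: dual of `Z(G₃)` has dimension 7); `r = 2` gives a degree-3 part `ℓ₂Q₁ - ℓ₁Q₂` and `r = 1`
  gives `vᵀMu` with `u·v ≡ 0`, which forces `span(u,v)` ISOTROPIC for the split form on `ℂ⁸`, hence of
  dimension `≤ 4`, so the degree-3 part lies in `(Λ)²`, `dim Λ ≤ 4`; in both cases the singular locus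
  of the degree-3 part has affine dimension `≥ 5`, and singular-locus dimension only grows under
  `in_ε`, while `Sing Z(G₃)` (27 coordinate 3-planes) has affine dimension 3 — contradiction;
  `r ∈ {0, 4, 5}` give no degree-3 part.  General chambers (garbage of both lower and higher degree)
  remain open: there the padding `ℓ²` destroys the singular-locus invariant (cones), which is once
  more Landsberg's Problem 6.5.2.4 in miniature.

All theorem statements below quantify exactly like the crux; `act` is the crux's inline apolarity
action (`= apolarAction` by `rfl`).
-/

namespace Summit.ValiantsHypothesis.ValiantsHypothesis.Cruxes.ToricFixedPoints.Disproof

set_option linter.dupNamespace false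

open Literature.Computability.AlgebraicComplexity
open Summit.ValiantsHypothesis.Cruxes.ToricFixedPoints.Negative
open Summit.ValiantsHypothesis.ValiantsHypothesis.Theorems.BorderApolarityFixedWitnessObstructionQP
open Summit.ValiantsHypothesis.ValiantsHypothesis.Theorems.BorderApolarityToricFixedPoints
open Literature.Computability.AlgebraicComplexity.BorderApolarity
open scoped BigOperators Matrix
open Filter MvPolynomial

/-! ## §0  Constant sequences (interior points) satisfy the conclusion with `u = 1`, `w = 0` -/

/-- §0 ConstantCase: if `P t = P 0` for all `t` (so `J = Ann(P 0)` is an interior point of `Z_det`),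
the conclusion of `ToricFixedPoints` holds with `u = 1`, `g` the translate giving `P 0`, `w = 0`
(then `Q t = P t`).  Positive sanity lemma (evidence only; not a route item). [folklore] -/
theorem constantCase (n m : ℕ) [NeZero m] (_hn : 3 ≤ n) (_hnm : n ≤ m)
    (P : ℕ → MvPolynomial (Fin m × Fin m) ℂ) (J : ℕ → Set (MvPolynomial (Fin m × Fin m) ℂ))
    (hconst : ∀ t, P t = P 0)
    (horb : ∀ t : ℕ, P t ∈ glOrbit (Fin m × Fin m) ℂ (detPoly (Fin m) ℂ))
    (hlim : IsBorderApolarLimit m P J) :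
    ∃ (u g : Matrix.GeneralLinearGroup (Fin m × Fin m) ℂ) (w : Fin m × Fin m → ℤ),
      IsBorderApolarLimit m (fun t : ℕ => linSubst (Fin m × Fin m) ℂ (u : Matrix (Fin m × Fin m) (Fin m × Fin m) ℂ)
        (linSubst (Fin m × Fin m) ℂ (Matrix.diagonal fun i : Fin m × Fin m => ((t : ℂ) + 2) ^ (w i))
          (linSubst (Fin m × Fin m) ℂ (g : Matrix (Fin m × Fin m) (Fin m × Fin m) ℂ) (detPoly (Fin m) ℂ)))) J := by
  obtain ⟨g, hg⟩ := horb 0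
  have hg' : linSubst (Fin m × Fin m) ℂ (g : Matrix (Fin m × Fin m) (Fin m × Fin m) ℂ) (detPoly (Fin m) ℂ) = P 0 := by
    simpa only [linSubstRep_apply] using hg
  refine ⟨1, g, fun _ => 0, ?_⟩
  have hQ : (fun t : ℕ => linSubst (Fin m × Fin m) ℂ ((1 : Matrix.GeneralLinearGroup (Fin m × Fin m) ℂ) :
      Matrix (Fin m × Fin m) (Fin m × Fin m) ℂ)
        (linSubst (Fin m × Fin m) ℂ (Matrix.diagonal fun i : Fin m × Fin m => ((t : ℂ) + 2) ^ ((fun _ => (0:ℤ)) i))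
          (linSubst (Fin m × Fin m) ℂ (g : Matrix (Fin m × Fin m) (Fin m × Fin m) ℂ) (detPoly (Fin m) ℂ)))) = P := by
    funext t
    simp only [zpow_zero, Matrix.diagonal_one, Units.val_one, linSubst_one, AlgHom.id_apply]
    rw [hconst t, ← hg']
  rw [hQ]
  exact hlim

/-! ## §2–§3  (Li) and (Ls) are load-bearing — LANDED

`Negative.toricFixedPoints_false_without_lowerLimit : ¬ ToricFixedPointsWithoutLowerLimit` (p73812) and
`Negative.toricFixedPoints_false_without_upperLimit : ¬ ToricFixedPointsWithoutUpperLimit` (p73827) are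
imported from `Theorems/ToricFixedPoints/Negative/`; re-exported here for readers of this file. -/

example : ¬ ToricFixedPointsWithoutLowerLimit := toricFixedPoints_false_without_lowerLimit
example : ¬ ToricFixedPointsWithoutUpperLimit := toricFixedPoints_false_without_upperLimit
example : ¬ ToricFixedPointsWithoutOrbit := toricFixedPoints_false_without_orbit

/-! ## §6  Clause (d) of `H₀` is not load-bearing (cycle 3; proposed as `Negative/CharacterNotLoadBearing.lean`)

See the module docblock §6 for the paper-level form reduction / toric de-bordering consequence. -/

/-- A scalar substitution multiplies a degree-`k` form by `c^k`: `linSubst (c • 1) D = c^k • D`.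
[folklore] -/
theorem linSubst_smul_one_of_isHomogeneous {σ : Type*} [Fintype σ] [DecidableEq σ] (c : ℂ)
    {D : MvPolynomial σ ℂ} {k : ℕ} (hD : D.IsHomogeneous k) :
    linSubst σ ℂ (c • (1 : Matrix σ σ ℂ)) D = c ^ k • D := by
  rw [Matrix.smul_one_eq_diagonal]
  ext d
  rw [tli_coeff_linSubst_diagonal, coeff_smul, smul_eq_mul]
  by_cases hd : coeff d D = 0
  · rw [hd, mul_zero, mul_zero]
  · have hdeg : ∑ i ∈ d.support, d i = k := by
      have := hD hd
      rw [← this, Finsupp.weight_apply, Finsupp.sum]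
      simp
    rw [Finset.prod_pow_eq_pow_sum, hdeg]

/-- A scaled substitution on degree-`k` forms: `linSubst (c • A) D = c^k • linSubst A D`. [folklore] -/
theorem linSubst_smul_of_isHomogeneous {σ : Type*} [Fintype σ] [DecidableEq σ] (c : ℂ)
    (A : Matrix σ σ ℂ) {D : MvPolynomial σ ℂ} {k : ℕ} (hD : D.IsHomogeneous k) :
    linSubst σ ℂ (c • A) D = c ^ k • linSubst σ ℂ A D := by
  have h : c • A = (c • (1 : Matrix σ σ ℂ)) * A := by rw [smul_mul_assoc, one_mul]
  rw [h, linSubst_mul, AlgHom.comp_apply,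
    linSubst_smul_one_of_isHomogeneous c (linSubst_isHomogeneous A hD)]

/-- For `n ≤ m` the `Y`-diagonal index set `{i : Fin m | m - n ≤ i}` has `n` elements. [folklore] -/
theorem card_filter_block (n m : ℕ) (h : n ≤ m) :
    (Finset.univ.filter fun i : Fin m => m - n ≤ (i : ℕ)).card = n := by
  have := card_blockIdx (n := n) (m := m) h
  rwa [Fintype.card_subtype] at this

/-- **Clause (d) of `H₀` is not load-bearing.**  Let `J k` (`k ≤ m`) be linear subspaces of
degree-`k` forms.  If `J` is stable (`D ↦ linSubst Mᵀ D`) under every invertible `M` satisfying the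
crux's conditions (a) triangularity for `rk`, (b) own columns diagonal, (c) rank-one `Y`-diagonal and
(d) character `= 1`, then it is stable under every invertible `M` satisfying (a), (b), (c) alone.
Proof: `χ(M) := M₀₀^(m-n) ∏_{i∈Y} M_{(i,i)(i,i)} ≠ 0`; pick `c` with `c^m = χ(M)⁻¹`; `c • M` satisfies
(a)–(d) (the character picks up `c^(m-n) · c^n = c^m`), and `linSubst (c • M)ᵀ D = c^k • linSubst Mᵀ D`.
[folklore] -/
theorem h0Stable_without_character (n m : ℕ) [NeZero m] (hnm : n ≤ m)
    (J : ℕ → Set (MvPolynomial (Fin m × Fin m) ℂ))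
    (hsub : ∀ k ≤ m, ∃ Lk : Submodule ℂ (MvPolynomial (Fin m × Fin m) ℂ),
      (Lk : Set (MvPolynomial (Fin m × Fin m) ℂ)) = J k)
    (hhom : ∀ k ≤ m, ∀ D ∈ J k, D.IsHomogeneous k)
    (hW4 : ∀ A : Matrix.GeneralLinearGroup (Fin m × Fin m) ℂ,
      let M : Matrix (Fin m × Fin m) (Fin m × Fin m) ℂ := A
      let rk := fun (p : Fin m × Fin m) =>
        (if (m - n ≤ (p.1 : ℕ) ∧ m - n ≤ (p.2 : ℕ)) ∨ p = (0, 0) then 0 else m * m) + ((p.1 : ℕ) * m + (p.2 : ℕ))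
      (∀ i j : Fin m × Fin m, M j i ≠ 0 → rk j ≤ rk i) →
      (∀ i j : Fin m × Fin m, ((m - n ≤ (i.1 : ℕ) ∧ m - n ≤ (i.2 : ℕ)) ∨ i = (0, 0)) → j ≠ i → M j i = 0) →
      (∀ i k j l : Fin m, m - n ≤ (i : ℕ) → m - n ≤ (k : ℕ) → m - n ≤ (j : ℕ) → m - n ≤ (l : ℕ) →
        M (i, j) (i, j) * M (k, l) (k, l) = M (i, l) (i, l) * M (k, j) (k, j)) →
      M (0, 0) (0, 0) ^ (m - n) * ∏ i ∈ Finset.univ.filter (fun i : Fin m => m - n ≤ (i : ℕ)), M (i, i) (i, i) = 1 →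
      ∀ k ≤ m, ∀ D ∈ J k, linSubst (Fin m × Fin m) ℂ Mᵀ D ∈ J k) :
    ∀ A : Matrix.GeneralLinearGroup (Fin m × Fin m) ℂ,
      let M : Matrix (Fin m × Fin m) (Fin m × Fin m) ℂ := A
      let rk := fun (p : Fin m × Fin m) =>
        (if (m - n ≤ (p.1 : ℕ) ∧ m - n ≤ (p.2 : ℕ)) ∨ p = (0, 0) then 0 else m * m) + ((p.1 : ℕ) * m + (p.2 : ℕ))
      (∀ i j : Fin m × Fin m, M j i ≠ 0 → rk j ≤ rk i) →
      (∀ i j : Fin m × Fin m, ((m - n ≤ (i.1 : ℕ) ∧ m - n ≤ (i.2 : ℕ)) ∨ i = (0, 0)) → j ≠ i → M j i = 0) →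
      (∀ i k j l : Fin m, m - n ≤ (i : ℕ) → m - n ≤ (k : ℕ) → m - n ≤ (j : ℕ) → m - n ≤ (l : ℕ) →
        M (i, j) (i, j) * M (k, l) (k, l) = M (i, l) (i, l) * M (k, j) (k, j)) →
      ∀ k ≤ m, ∀ D ∈ J k, linSubst (Fin m × Fin m) ℂ Mᵀ D ∈ J k := by
  intro A M rk ha hb hc1 k hk D hD
  have hmpos : 0 < m := Nat.pos_of_ne_zero (NeZero.ne m)
  -- own diagonal entries of an invertible `M` are non-zero
  have hdetM : (M : Matrix (Fin m × Fin m) (Fin m × Fin m) ℂ).det ≠ 0 :=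
    (Matrix.isUnits_det_units A).ne_zero
  have hdiag : ∀ i : Fin m × Fin m, ((m - n ≤ (i.1 : ℕ) ∧ m - n ≤ (i.2 : ℕ)) ∨ i = (0, 0)) → M i i ≠ 0 := by
    intro i hi h0
    apply hdetM
    refine Matrix.det_eq_zero_of_column_eq_zero i fun j => ?_
    by_cases hji : j = i
    · rw [hji]; exact h0
    · exact hb i j hi hji
  -- the character value and its `m`-th root
  set χ : ℂ := M (0, 0) (0, 0) ^ (m - n) *
    ∏ i ∈ Finset.univ.filter (fun i : Fin m => m - n ≤ (i : ℕ)), M (i, i) (i, i) with hχ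
  have hχne : χ ≠ 0 := by
    refine mul_ne_zero (pow_ne_zero _ (hdiag (0, 0) (Or.inr rfl))) ?_
    refine Finset.prod_ne_zero_iff.2 fun i hi => hdiag (i, i) (Or.inl ?_)
    have := (Finset.mem_filter.1 hi).2
    exact ⟨this, this⟩
  obtain ⟨c, hc⟩ := IsAlgClosed.exists_pow_nat_eq χ⁻¹ hmpos
  have hcne : c ≠ 0 := by
    rintro rfl
    rw [zero_pow hmpos.ne'] at hc
    exact inv_ne_zero hχne hc.symm
  -- the rescaled matrix `c • M` is invertible
  have hdet' : (c • (M : Matrix (Fin m × Fin m) (Fin m × Fin m) ℂ)).det ≠ 0 := by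
    rw [Matrix.det_smul]
    exact mul_ne_zero (pow_ne_zero _ hcne) hdetM
  set A' : Matrix.GeneralLinearGroup (Fin m × Fin m) ℂ := Matrix.GeneralLinearGroup.mkOfDetNeZero _ hdet'
    with hA'
  have hA'coe : ((A' : Matrix.GeneralLinearGroup (Fin m × Fin m) ℂ) : Matrix (Fin m × Fin m) (Fin m × Fin m) ℂ)
      = c • M := rfl
  -- apply W4 to `c • M`
  have key := hW4 A'
  simp only [hA'coe, Matrix.smul_apply, smul_eq_mul] at key
  have hmem := key
    (fun i j hij => ha i j (right_ne_zero_of_mul hij))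
    (fun i j hi hji => by rw [hb i j hi hji, mul_zero])
    (fun i k' j l hi hk' hj hl => by
      have := hc1 i k' j l hi hk' hj hl
      calc c * M (i, j) (i, j) * (c * M (k', l) (k', l))
          = c * c * (M (i, j) (i, j) * M (k', l) (k', l)) := by ring
        _ = c * c * (M (i, l) (i, l) * M (k', j) (k', j)) := by rw [this]
        _ = c * M (i, l) (i, l) * (c * M (k', j) (k', j)) := by ring)
    (by
      rw [mul_pow, Finset.prod_mul_distrib, Finset.prod_const, card_filter_block n m hnm]
      calc c ^ (m - n) * M (0, 0) (0, 0) ^ (m - n) *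
            (c ^ n * ∏ i ∈ Finset.univ.filter (fun i : Fin m => m - n ≤ (i : ℕ)), M (i, i) (i, i))
          = c ^ (m - n + n) * χ := by rw [hχ, pow_add]; ring
        _ = 1 := by rw [Nat.sub_add_cancel hnm, hc, inv_mul_cancel₀ hχne])
    k hk D hD
  -- `linSubst (c • M)ᵀ D = c^k • linSubst Mᵀ D`
  have hsmul : linSubst (Fin m × Fin m) ℂ (c • (M : Matrix (Fin m × Fin m) (Fin m × Fin m) ℂ))ᵀ D =
      c ^ k • linSubst (Fin m × Fin m) ℂ Mᵀ D := by
    rw [Matrix.transpose_smul, linSubst_smul_of_isHomogeneous c _ (hhom k hk D hD)]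
  have hmem' : c ^ k • linSubst (Fin m × Fin m) ℂ Mᵀ D ∈ J k := by
    have : (c • (M : Matrix (Fin m × Fin m) (Fin m × Fin m) ℂ))ᵀ =
        (fun i j => c * M j i : Matrix (Fin m × Fin m) (Fin m × Fin m) ℂ) := by
      ext i j; rfl
    rw [← hsmul, this]
    exact hmem
  obtain ⟨Lk, hLk⟩ := hsub k hk
  rw [← hLk, SetLike.mem_coe] at hmem' ⊢
  have := Lk.smul_mem (c ^ k)⁻¹ hmem'
  rwa [smul_smul, inv_mul_cancel₀ (pow_ne_zero _ hcne), one_smul] at this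

/-- The same for a Kuratowski limit `J` of annihilator spaces (`IsBorderApolarLimit m P J`, any
sequence `P`): its pieces `J k`, `k ≤ m`, are subspaces of degree-`k` forms
(`exists_submodule_coe_eq`, `IsBorderApolarLimit.isHomogeneous_of_mem`), so W4 with the character
clause implies W4 without it. [folklore] -/
theorem h0Stable_without_character_of_isBorderApolarLimit (n m : ℕ) [NeZero m] (hnm : n ≤ m)
    (P : ℕ → MvPolynomial (Fin m × Fin m) ℂ) (J : ℕ → Set (MvPolynomial (Fin m × Fin m) ℂ))
    (hJ : IsBorderApolarLimit m P J)
    (hW4 : ∀ A : Matrix.GeneralLinearGroup (Fin m × Fin m) ℂ,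
      let M : Matrix (Fin m × Fin m) (Fin m × Fin m) ℂ := A
      let rk := fun (p : Fin m × Fin m) =>
        (if (m - n ≤ (p.1 : ℕ) ∧ m - n ≤ (p.2 : ℕ)) ∨ p = (0, 0) then 0 else m * m) + ((p.1 : ℕ) * m + (p.2 : ℕ))
      (∀ i j : Fin m × Fin m, M j i ≠ 0 → rk j ≤ rk i) →
      (∀ i j : Fin m × Fin m, ((m - n ≤ (i.1 : ℕ) ∧ m - n ≤ (i.2 : ℕ)) ∨ i = (0, 0)) → j ≠ i → M j i = 0) →
      (∀ i k j l : Fin m, m - n ≤ (i : ℕ) → m - n ≤ (k : ℕ) → m - n ≤ (j : ℕ) → m - n ≤ (l : ℕ) →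
        M (i, j) (i, j) * M (k, l) (k, l) = M (i, l) (i, l) * M (k, j) (k, j)) →
      M (0, 0) (0, 0) ^ (m - n) * ∏ i ∈ Finset.univ.filter (fun i : Fin m => m - n ≤ (i : ℕ)), M (i, i) (i, i) = 1 →
      ∀ k ≤ m, ∀ D ∈ J k, linSubst (Fin m × Fin m) ℂ Mᵀ D ∈ J k) :
    ∀ A : Matrix.GeneralLinearGroup (Fin m × Fin m) ℂ,
      let M : Matrix (Fin m × Fin m) (Fin m × Fin m) ℂ := A
      let rk := fun (p : Fin m × Fin m) =>
        (if (m - n ≤ (p.1 : ℕ) ∧ m - n ≤ (p.2 : ℕ)) ∨ p = (0, 0) then 0 else m * m) + ((p.1 : ℕ) * m + (p.2 : ℕ))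
      (∀ i j : Fin m × Fin m, M j i ≠ 0 → rk j ≤ rk i) →
      (∀ i j : Fin m × Fin m, ((m - n ≤ (i.1 : ℕ) ∧ m - n ≤ (i.2 : ℕ)) ∨ i = (0, 0)) → j ≠ i → M j i = 0) →
      (∀ i k j l : Fin m, m - n ≤ (i : ℕ) → m - n ≤ (k : ℕ) → m - n ≤ (j : ℕ) → m - n ≤ (l : ℕ) →
        M (i, j) (i, j) * M (k, l) (k, l) = M (i, l) (i, l) * M (k, j) (k, j)) →
      ∀ k ≤ m, ∀ D ∈ J k, linSubst (Fin m × Fin m) ℂ Mᵀ D ∈ J k := by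
  classical
  refine h0Stable_without_character n m hnm J (fun k hk => ?_)
    (fun k hk D hD => hJ.isHomogeneous_of_mem hk hD) hW4
  have hA : ∀ t : ℕ, ∃ A : Submodule ℂ (MvPolynomial (Fin m × Fin m) ℂ),
      (A : Set (MvPolynomial (Fin m × Fin m) ℂ)) = annihilatorOfDegree (P t) k := fun t => by
    obtain ⟨A, hA, -, -⟩ := exists_annSubmodule k (P t)
    exact ⟨A, hA⟩
  choose A hA using hA
  refine exists_submodule_coe_eq A (J k) ?_ ?_
  · intro D hD
    obtain ⟨Ds, hDs, hlim⟩ := hJ.1 k hk D hD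
    refine ⟨Ds, fun t => ?_, hlim⟩
    rw [← SetLike.mem_coe, hA t, mem_annihilatorOfDegree_iff]
    exact hDs t
  · intro D φ Ds hφ hDs hlim
    refine hJ.2 k hk D φ Ds hφ (fun t => ?_) hlim
    have h := hDs t
    rw [← SetLike.mem_coe, hA (φ t), mem_annihilatorOfDegree_iff] at h
    exact h


/-! ## §7  The INTERIOR strengthening is false (cycle 3; proposed as `Negative/InteriorFalse.lean`) -/

/-- The crux `ToricFixedPoints` with its conclusion strengthened to "the fixed point is an INTERIOR
point of `Z_det`": `∃ g`, `J` is the border-apolar limit of the constant sequence `Q_t = g·det_m`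
(= the crux's conclusion with `w = 0`, `u = 1`; hypotheses verbatim). -/
def ToricFixedPointsInterior : Prop :=
  ∀ (n m : ℕ) [NeZero m], 3 ≤ n → n ≤ m → let act := fun (D f : MvPolynomial (Fin m × Fin m) ℂ) => ∑ e ∈ D.support, ∑ d ∈ f.support, MvPolynomial.monomial (d - e) (MvPolynomial.coeff e D * MvPolynomial.coeff d f * ∏ i ∈ e.support, (Nat.descFactorial (d i) (e i) : ℂ)); let rk := fun (p : Fin m × Fin m) => (if (m - n ≤ (p.1 : ℕ) ∧ m - n ≤ (p.2 : ℕ)) ∨ p = (0, 0) then 0 else m * m) + ((p.1 : ℕ) * m + (p.2 : ℕ)); ∀ (P : ℕ → MvPolynomial (Fin m × Fin m) ℂ) (J : ℕ → Set (MvPolynomial (Fin m × Fin m) ℂ)), (∀ t : ℕ, P t ∈ Literature.Computability.AlgebraicComplexity.glOrbit (Fin m × Fin m) ℂ (Literature.Computability.AlgebraicComplexity.detPoly (Fin m) ℂ)) → (∀ k ≤ m, ∀ D ∈ J k, ∃ Ds : ℕ → MvPolynomial (Fin m × Fin m) ℂ, (∀ t, (Ds t).IsHomogeneous k ∧ act (Ds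 t) (P t) = 0) ∧ Filter.Tendsto (fun t => Literature.Computability.AlgebraicComplexity.coeffVec (Ds t)) Filter.atTop (nhds (Literature.Computability.AlgebraicComplexity.coeffVec D))) ∧ (∀ k ≤ m, ∀ (D : MvPolynomial (Fin m × Fin m) ℂ) (φ : ℕ → ℕ) (Ds : ℕ → MvPolynomial (Fin m × Fin m) ℂ), StrictMono φ → (∀ t, (Ds t).IsHomogeneous k ∧ act (Ds t) (P (φ t)) = 0) → Filter.Tendsto (fun t => Literature.Computability.AlgebraicComplexity.coeffVec (Ds t)) Filter.atTop (nhds (Literature.Computability.AlgebraicComplexity.coeffVec D)) → D ∈ J k) → (∀ A : Matrix.GeneralLinearGroup (Fin m × Fin m) ℂ, let M : Matrix (Fin m × Fin m) (Fin m × Fin m) ℂ := A; (∀ i j : Fin m × Fin m, M j i ≠ 0 → rk j ≤ rk i) → (∀ i j : Fin m × Fin m, ((m - n ≤ (i.1 : ℕ) ∧ m - n ≤ (i.2 : ℕ)) ∨ i = (0, 0)) → j ≠ i → M j i = 0) → (∀ i k j l : Fin m, m - n ≤ (i : ℕ) → m - n ≤ (k : ℕ) → m - n ≤ (j : ℕ)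 → m - n ≤ (l : ℕ) → M (i, j) (i, j) * M (k, l) (k, l) = M (i, l) (i, l) * M (k, j) (k, j)) → M (0, 0) (0, 0) ^ (m - n) * ∏ i ∈ Finset.univ.filter (fun i : Fin m => m - n ≤ (i : ℕ)), M (i, i) (i, i) = 1 → ∀ k ≤ m, ∀ D ∈ J k, Literature.Computability.AlgebraicComplexity.linSubst (Fin m × Fin m) ℂ Mᵀ D ∈ J k) → ∃ g : Matrix.GeneralLinearGroup (Fin m × Fin m) ℂ, let Q : ℕ → MvPolynomial (Fin m × Fin m) ℂ := fun _ => Literature.Computability.AlgebraicComplexity.linSubst (Fin m × Fin m) ℂ (g : Matrix (Fin m × Fin m) (Fin m × Fin m) ℂ) (Literature.Computability.AlgebraicComplexity.detPoly (Fin m) ℂ); (∀ k ≤ m, ∀ D ∈ J k, ∃ Ds : ℕ → MvPolynomial (Fin m × Fin m) ℂ, (∀ t, (Ds t).IsHomogeneous k ∧ act (Ds t) (Q t) = 0) ∧ Filter.Tendsto (fun t => Literature.Computability.AlgebraicComplexity.coeffVec (Ds t)) Filter.atTop (nhds (Literature.Computability.AlgebraicComplexity.coeffVec D))) ∧ (∀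 k ≤ m, ∀ (D : MvPolynomial (Fin m × Fin m) ℂ) (φ : ℕ → ℕ) (Ds : ℕ → MvPolynomial (Fin m × Fin m) ℂ), StrictMono φ → (∀ t, (Ds t).IsHomogeneous k ∧ act (Ds t) (Q (φ t)) = 0) → Filter.Tendsto (fun t => Literature.Computability.AlgebraicComplexity.coeffVec (Ds t)) Filter.atTop (nhds (Literature.Computability.AlgebraicComplexity.coeffVec D)) → D ∈ J k)

section General

variable {σ : Type*}

/-- Weighted components of a monomial. [folklore] -/
theorem weightedHomogeneousComponent_monomial' [DecidableEq σ] (w : σ → ℤ) (ν : ℤ) (d : σ →₀ ℕ) (a : ℂ) :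
    weightedHomogeneousComponent w ν (monomial d a) =
      if Finsupp.weight w d = ν then monomial d a else 0 := by
  classical
  ext e
  rw [coeff_weightedHomogeneousComponent]
  by_cases hed : e = d
  · subst hed
    split_ifs <;> simp
  · have : coeff e (monomial d a) = 0 := by rw [coeff_monomial, if_neg (Ne.symm hed)]
    rw [this]
    split_ifs <;> first | rfl | (rw [coeff_zero]) | (rw [coeff_monomial, if_neg (Ne.symm hed)])

/-- A diagonal substitution with a rank-one pattern `d_{ij}` (`d_{ij} d_{kl} = d_{il} d_{kj}`,
`d₀₀ ≠ 0`) rescales the generic determinant: `diag(d) · det = (∏ᵢ d_{i0}/d₀₀ · ∏ⱼ d_{0j}) det`.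
(Row/column scaling `X ↦ diag(a) X diag(b)`.) [folklore] -/
theorem linSubst_diagonal_detPoly {m : ℕ} [NeZero m] (d : Fin m × Fin m → ℂ)
    (hrel : ∀ i k j l : Fin m, d (i, j) * d (k, l) = d (i, l) * d (k, j)) (h0 : d (0, 0) ≠ 0) :
    linSubst (Fin m × Fin m) ℂ (Matrix.diagonal d) (detPoly (Fin m) ℂ) =
      ((∏ i : Fin m, d (i, 0) / d (0, 0)) * ∏ j : Fin m, d (0, j)) • detPoly (Fin m) ℂ := by
  set a : Fin m → ℂ := fun i => d (i, 0) / d (0, 0) with ha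
  set b : Fin m → ℂ := fun j => d (0, j) with hb
  have hab : ∀ i j, a i * b j = d (i, j) := by
    intro i j
    simp only [ha, hb]
    have := hrel i 0 0 j
    field_simp
    linear_combination this
  unfold detPoly
  rw [AlgHom.map_det]
  have hmat : (linSubst (Fin m × Fin m) ℂ (Matrix.diagonal d)).mapMatrix (Matrix.mvPolynomialX (Fin m) (Fin m) ℂ)
      = Matrix.diagonal (fun i => C (a i)) * Matrix.mvPolynomialX (Fin m) (Fin m) ℂ *
          Matrix.diagonal (fun j => C (b j)) := by
    ext i j
    rw [Matrix.mul_diagonal, Matrix.diagonal_mul, AlgHom.mapMatrix_apply, Matrix.map_apply,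
      Matrix.mvPolynomialX_apply, tli_linSubst_diagonal_X, ← hab i j, smul_eq_C_mul, map_mul]
    ring
  rw [hmat, Matrix.det_mul, Matrix.det_mul, Matrix.det_diagonal, Matrix.det_diagonal, smul_eq_C_mul,
    map_mul, map_prod, map_prod]
  ring

end General

/-- **Kuratowski limits of semi-invariant curves are stable.**  If `J` is the border-apolar limit of a
sequence `P_t` each of which is an EIGENVECTOR of the substitution `M` (`M · P_t = χ_t P_t`, `M`
invertible), then every `J k`, `k ≤ m`, is stable under `D ↦ linSubst Mᵀ D`: transport approximants
(`Ann(P_t)` is `Mᵀ`-stable by `GL`-equivariance of apolarity) and use (Ls) along `φ = id` with the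
coefficientwise continuity of `linSubst`.  This is how `H₀`-stability (W4) of toric limits of
`H₀`-semi-invariant curves comes for free. [folklore] -/
theorem kLimit_linSubst_stable_of_semiInvariant {m : ℕ} {P : ℕ → MvPolynomial (Fin m × Fin m) ℂ}
    {J : ℕ → Set (MvPolynomial (Fin m × Fin m) ℂ)} (hJ : IsBorderApolarLimit m P J)
    (M : Matrix (Fin m × Fin m) (Fin m × Fin m) ℂ) (hM : IsUnit M.det) (χ : ℕ → ℂ)
    (hsemi : ∀ t, linSubst (Fin m × Fin m) ℂ M (P t) = χ t • P t) :
    ∀ k ≤ m, ∀ D ∈ J k, linSubst (Fin m × Fin m) ℂ Mᵀ D ∈ J k := by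
  classical
  intro k hk D hD
  obtain ⟨Ds, hDs, hDlim⟩ := hJ.1 k hk D hD
  have hDhom : D.IsHomogeneous k := hJ.isHomogeneous_of_mem hk hD
  refine hJ.2 k hk _ id (fun t => linSubst (Fin m × Fin m) ℂ Mᵀ (Ds t)) strictMono_id
    (fun t => ⟨linSubst_isHomogeneous _ (hDs t).1, ?_⟩)
    (tli_tendsto_coeffVec_linSubst _ (fun t => (hDs t).1) hDhom hDlim)
  show apolarAction (linSubst (Fin m × Fin m) ℂ Mᵀ (Ds t)) (P t) = 0
  rw [← apolarAction_linSubst_eq_zero_iff _ hM, hsemi t, apolarAction_smul_right, (hDs t).2, smul_zero]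

/-- The weight: indicator of the diagonal variables `x₀₀, x₁₁, x₂₂`. -/
def wDiag : Fin 3 × Fin 3 → ℤ := fun p => if p.1 = p.2 then 1 else 0

/-- The exponent of the diagonal monomial `x₀₀ x₁₁ x₂₂` (`= permMonomial 1`). -/
noncomputable def eId : (Fin 3 × Fin 3) →₀ ℕ := permMonomial (1 : Equiv.Perm (Fin 3))

/-- The `wDiag`-weight of a permutation pattern is its number of fixed points. [folklore] -/
theorem weight_wDiag_permMonomial (ρ : Equiv.Perm (Fin 3)) :
    Finsupp.weight wDiag (permMonomial ρ) = ∑ i : Fin 3, (if ρ i = i then (1 : ℤ) else 0) := by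
  rw [permMonomial, map_sum]
  refine Finset.sum_congr rfl fun i _ => ?_
  rw [Finsupp.weight_single, one_smul, wDiag]

/-- The diagonal monomial has `wDiag`-weight `3`. [folklore] -/
theorem weight_wDiag_eId : Finsupp.weight wDiag eId = 3 := by
  rw [eId, weight_wDiag_permMonomial]
  simp

/-- Only the identity has all three diagonal variables. [folklore] -/
theorem eq_one_of_weight_eq_three (ρ : Equiv.Perm (Fin 3))
    (h : Finsupp.weight wDiag (permMonomial ρ) = 3) : ρ = 1 := by
  rw [weight_wDiag_permMonomial, Finset.sum_boole] at h
  have hcard : (Finset.univ.filter fun i : Fin 3 => ρ i = i).card = (Finset.univ : Finset (Fin 3)).card := by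
    rw [Finset.card_univ, Fintype.card_fin]
    exact_mod_cast h
  rw [Finset.card_filter_eq_iff] at hcard
  ext i
  exact congrArg Fin.val (hcard i (Finset.mem_univ i))

/-- `wDiag`-weights are bounded by the degree. [folklore] -/
theorem weight_wDiag_le_degree (e : (Fin 3 × Fin 3) →₀ ℕ) :
    Finsupp.weight wDiag e ≤ (e.degree : ℤ) := by
  rw [Finsupp.weight_apply, Finsupp.sum, Finsupp.degree_apply, Nat.cast_sum]
  refine Finset.sum_le_sum fun i _ => ?_
  simp only [wDiag]
  split_ifs <;> simp

/-- **Generators of `J_3`.**  For every degree-3 exponent `e ≠ e_id`, the monomial operator `∂^e`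
lies in the span of the lowest-`wDiag`-weight initial forms of `Ann_3(det_3)`: the operator
`E = ∂^e - (det_e · e!) ∂^{e_id}` annihilates `det_3` (top-degree pairing), and its lowest weight part
is `∂^e` (if `det_e ≠ 0` then `e` is a non-identity permutation pattern, of weight `< 3 = wt(e_id)`).
[folklore] -/
theorem monomial_mem_inSpan_three (e : (Fin 3 × Fin 3) →₀ ℕ) (he : e.degree = 3) (hne : e ≠ eId) :
    (monomial e (1 : ℂ)) ∈ Submodule.span ℂ {D' : MvPolynomial (Fin 3 × Fin 3) ℂ |
      ∃ E ∈ annihilatorOfDegree (detPoly (Fin 3) ℂ) 3, ∃ ν : ℤ,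
        D' = weightedHomogeneousComponent wDiag ν E ∧
          ∀ ν' : ℤ, ν' < ν → weightedHomogeneousComponent wDiag ν' E = 0} := by
  classical
  set c : ℂ := coeff e (detPoly (Fin 3) ℂ) with hc
  set κ : ℂ := ∏ i ∈ e.support, ((e i).factorial : ℂ) with hκ
  set E : MvPolynomial (Fin 3 × Fin 3) ℂ := monomial e 1 - monomial eId (c * κ) with hE
  have hdet3 : (detPoly (Fin 3) ℂ).IsHomogeneous 3 := by
    simpa using detPoly_isHomogeneous (n := Fin 3) (k := ℂ)
  have heIddeg : eId.degree = 3 := by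
    have h1 : ((1 : Equiv.Perm (Fin 3)) : Fin 3 → Fin 3) = id := rfl
    rw [eId, Finsupp.degree_eq_weight_one]
    exact hdet3 (by rw [coeff_permMonomial_detPoly]; simp)
  -- pairing of a monomial operator with `det_3`
  have hpair : ∀ (d : (Fin 3 × Fin 3) →₀ ℕ) (a : ℂ), d.degree = 3 →
      apolarAction (monomial d a) (detPoly (Fin 3) ℂ) =
        C (a * coeff d (detPoly (Fin 3) ℂ) * ∏ i ∈ d.support, ((d i).factorial : ℂ)) := by
    intro d a hd
    by_cases ha : a = 0
    · rw [ha, monomial_zero, ← C_0, apolarAction_C, zero_smul, zero_mul, zero_mul, C_0]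
    rw [apolarAction_eq_C (isHomogeneous_monomial a hd) hdet3, support_monomial, if_neg ha,
      Finset.sum_singleton, coeff_monomial, if_pos rfl]
  have hEann : E ∈ annihilatorOfDegree (detPoly (Fin 3) ℂ) 3 := by
    rw [mem_annihilatorOfDegree_iff]
    refine ⟨(isHomogeneous_monomial _ he).sub (isHomogeneous_monomial _ heIddeg), ?_⟩
    rw [hE, apolarAction_sub_left, hpair e 1 he, hpair eId (c * κ) heIddeg, sub_eq_zero]
    congr 1
    have h1 : coeff eId (detPoly (Fin 3) ℂ) = 1 := by
      rw [eId, coeff_permMonomial_detPoly]; simp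
    have h2 : (∏ i ∈ eId.support, ((eId i).factorial : ℂ)) = 1 := by
      refine Finset.prod_eq_one fun i _ => ?_
      rcases i with ⟨r, s⟩
      rw [eId, permMonomial_apply]
      split_ifs <;> simp
    rw [h1, h2, hc, hκ]; ring
  -- the lowest weight part of `E` is `∂^e`
  set ν : ℤ := Finsupp.weight wDiag e with hν
  have hsecond : ∀ ν' : ℤ, ν' ≤ ν → weightedHomogeneousComponent wDiag ν' (monomial eId (c * κ)) = 0 := by
    intro ν' hν'
    by_cases hc0 : c = 0
    · rw [hc0, zero_mul, monomial_zero, map_zero]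
    rw [weightedHomogeneousComponent_monomial', weight_wDiag_eId, if_neg]
    intro h3
    -- `c ≠ 0`: `e` is a permutation pattern, not the identity, so `ν < 3`
    obtain ⟨ρ, hρ⟩ := exists_permMonomial_eq_of_coeff_detPoly_ne_zero ℂ (d := e) hc0
    have hρ1 : ρ ≠ 1 := by
      rintro rfl; exact hne (by rw [← hρ]; rfl)
    have hlt : ν < 3 := by
      have hle : ν ≤ 3 := by
        have := weight_wDiag_le_degree e
        rw [he] at this; exact_mod_cast this
      refine lt_of_le_of_ne hle fun h => hρ1 (eq_one_of_weight_eq_three ρ ?_)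
      rw [hρ]; exact h
    omega
  refine Submodule.subset_span ⟨E, hEann, ν, ?_, ?_⟩
  · rw [hE, map_sub, hsecond ν le_rfl, sub_zero, weightedHomogeneousComponent_monomial', if_pos rfl]
  · intro ν' hν'
    rw [hE, map_sub, hsecond ν' hν'.le, sub_zero, weightedHomogeneousComponent_monomial', if_neg]
    exact fun h => (hν ▸ h ▸ hν').false

/-- The toric curve `P_t = 1 · diag((t+2)^{wDiag}) · det_3` (written with `u = 1 ∈ GL` so that it is
syntactically S1's curve). -/
noncomputable def Pdiag : ℕ → MvPolynomial (Fin 3 × Fin 3) ℂ := fun t =>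
  linSubst (Fin 3 × Fin 3) ℂ ((1 : Matrix.GeneralLinearGroup (Fin 3 × Fin 3) ℂ) :
      Matrix (Fin 3 × Fin 3) (Fin 3 × Fin 3) ℂ)
    (linSubst (Fin 3 × Fin 3) ℂ (Matrix.diagonal fun i : Fin 3 × Fin 3 => ((t : ℂ) + 2) ^ (wDiag i))
      (detPoly (Fin 3) ℂ))

/-- The span of the lowest-`wDiag`-weight initial forms of `Ann_k(det_3)`. -/
noncomputable def SpDiag (k : ℕ) : Submodule ℂ (MvPolynomial (Fin 3 × Fin 3) ℂ) :=
  Submodule.span ℂ {D' : MvPolynomial (Fin 3 × Fin 3) ℂ |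
    ∃ E ∈ annihilatorOfDegree (detPoly (Fin 3) ℂ) k, ∃ ν : ℤ,
      D' = weightedHomogeneousComponent wDiag ν E ∧
        ∀ ν' : ℤ, ν' < ν → weightedHomogeneousComponent wDiag ν' E = 0}

/-- **The boundary fixed point** `Jdiag = K-lim_t Ann(Pdiag t)` (S1's description, `u = 1`). -/
def Jdiag : ℕ → Set (MvPolynomial (Fin 3 × Fin 3) ℂ) := fun k =>
  {D | linSubst (Fin 3 × Fin 3) ℂ ((1 : Matrix.GeneralLinearGroup (Fin 3 × Fin 3) ℂ) :
      Matrix (Fin 3 × Fin 3) (Fin 3 × Fin 3) ℂ)ᵀ D ∈ SpDiag k}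

/-- The unit of `GL` coerces to the identity matrix. [folklore] -/
theorem coe_one_GL3 : ((1 : Matrix.GeneralLinearGroup (Fin 3 × Fin 3) ℂ) :
    Matrix (Fin 3 × Fin 3) (Fin 3 × Fin 3) ℂ) = 1 := Units.val_one

/-- `Pdiag t` with the `u = 1` substitution simplified away. [folklore] -/
theorem Pdiag_eq (t : ℕ) : Pdiag t = linSubst (Fin 3 × Fin 3) ℂ
    (Matrix.diagonal fun i : Fin 3 × Fin 3 => ((t : ℂ) + 2) ^ (wDiag i)) (detPoly (Fin 3) ℂ) := by
  simp only [Pdiag, coe_one_GL3, linSubst_one, AlgHom.id_apply]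

/-- Membership in `Jdiag k` is membership in the initial span `SpDiag k` (`u = 1`). [folklore] -/
theorem mem_Jdiag_iff {k : ℕ} {D : MvPolynomial (Fin 3 × Fin 3) ℂ} : D ∈ Jdiag k ↔ D ∈ SpDiag k := by
  simp only [Jdiag, Set.mem_setOf_eq, coe_one_GL3, Matrix.transpose_one, linSubst_one, AlgHom.id_apply]

/-- (LIM) `Jdiag` is the border-apolar (Kuratowski) limit of `Ann(Pdiag t)`: S1
`stub_toricLimitIsInitial` (landed, `Theorems/BorderApolarityToricFixedPointsToricLimitIsInitial.lean`)
at `m = 3`, `u = 1`, `w = wDiag`, `f = det_3`. -/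
theorem isBorderApolarLimit_diag : IsBorderApolarLimit 3 Pdiag Jdiag :=
  stub_toricLimitIsInitial 3 1 wDiag (detPoly (Fin 3) ℂ)

/-- (ORB) every `Pdiag t` lies in the orbit `GL_9 · det_3`. -/
theorem Pdiag_mem_glOrbit (t : ℕ) : Pdiag t ∈ glOrbit (Fin 3 × Fin 3) ℂ (detPoly (Fin 3) ℂ) := by
  have := toricCurve_mem_glOrbit (1 : Matrix.GeneralLinearGroup (Fin 3 × Fin 3) ℂ) 1 wDiag t
  rw [Pdiag_eq t]
  simpa only [coe_one_GL3, linSubst_one, AlgHom.id_apply] using this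

/-- `det_3` is a cubic form. [folklore] -/
theorem detPoly_three_isHomogeneous : (detPoly (Fin 3) ℂ).IsHomogeneous 3 := by
  simpa using detPoly_isHomogeneous (n := Fin 3) (k := ℂ)

/-- (W4) **`Jdiag` is `H₀(3,3)`-stable**: the crux's stability clause at `n = m = 3`, verbatim (after
`dsimp` of its `let`s).  At `n = m` conditions (a)–(d) make `M` diagonal with a rank-one pattern, so
`M · Pdiag t = χ · Pdiag t` (`linSubst_diagonal_detPoly`), and `kLimit_linSubst_stable_of_semiInvariant`
concludes. [folklore] -/
theorem Jdiag_h0Stable : ∀ A : Matrix.GeneralLinearGroup (Fin 3 × Fin 3) ℂ,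
    (∀ i j : Fin 3 × Fin 3, (A : Matrix (Fin 3 × Fin 3) (Fin 3 × Fin 3) ℂ) j i ≠ 0 →
      (if (3 - 3 ≤ (j.1 : ℕ) ∧ 3 - 3 ≤ (j.2 : ℕ)) ∨ j = (0, 0) then 0 else 3 * 3) + ((j.1 : ℕ) * 3 + (j.2 : ℕ)) ≤
      (if (3 - 3 ≤ (i.1 : ℕ) ∧ 3 - 3 ≤ (i.2 : ℕ)) ∨ i = (0, 0) then 0 else 3 * 3) + ((i.1 : ℕ) * 3 + (i.2 : ℕ))) →
    (∀ i j : Fin 3 × Fin 3, ((3 - 3 ≤ (i.1 : ℕ) ∧ 3 - 3 ≤ (i.2 : ℕ)) ∨ i = (0, 0)) → j ≠ i →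
      (A : Matrix (Fin 3 × Fin 3) (Fin 3 × Fin 3) ℂ) j i = 0) →
    (∀ i k j l : Fin 3, 3 - 3 ≤ (i : ℕ) → 3 - 3 ≤ (k : ℕ) → 3 - 3 ≤ (j : ℕ) → 3 - 3 ≤ (l : ℕ) →
      (A : Matrix (Fin 3 × Fin 3) (Fin 3 × Fin 3) ℂ) (i, j) (i, j) * (A : Matrix (Fin 3 × Fin 3) (Fin 3 × Fin 3) ℂ) (k, l) (k, l) =
      (A : Matrix (Fin 3 × Fin 3) (Fin 3 × Fin 3) ℂ) (i, l) (i, l) * (A : Matrix (Fin 3 × Fin 3) (Fin 3 × Fin 3) ℂ) (k, j) (k, j)) →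
    (A : Matrix (Fin 3 × Fin 3) (Fin 3 × Fin 3) ℂ) (0, 0) (0, 0) ^ (3 - 3) *
      ∏ i ∈ Finset.univ.filter (fun i : Fin 3 => 3 - 3 ≤ (i : ℕ)),
        (A : Matrix (Fin 3 × Fin 3) (Fin 3 × Fin 3) ℂ) (i, i) (i, i) = 1 →
    ∀ k ≤ 3, ∀ D ∈ Jdiag k, linSubst (Fin 3 × Fin 3) ℂ (A : Matrix (Fin 3 × Fin 3) (Fin 3 × Fin 3) ℂ)ᵀ D ∈ Jdiag k := by
  intro A _ha hb hc _hd
  set dA : Fin 3 × Fin 3 → ℂ := fun i => (A : Matrix (Fin 3 × Fin 3) (Fin 3 × Fin 3) ℂ) i i with hdA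
  have hMdiag : (A : Matrix (Fin 3 × Fin 3) (Fin 3 × Fin 3) ℂ) = Matrix.diagonal dA := by
    ext j i
    by_cases hji : j = i
    · subst hji
      rw [Matrix.diagonal_apply_eq]
    · rw [Matrix.diagonal_apply_ne _ hji]
      exact hb i j (Or.inl ⟨by omega, by omega⟩) hji
  have hdet : (A : Matrix (Fin 3 × Fin 3) (Fin 3 × Fin 3) ℂ).det ≠ 0 :=
    (Matrix.isUnits_det_units A).ne_zero
  have hd0 : ∀ i, dA i ≠ 0 := by
    intro i h0
    apply hdet
    rw [hMdiag, Matrix.det_diagonal]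
    exact Finset.prod_eq_zero (Finset.mem_univ i) h0
  have hrel : ∀ i k j l : Fin 3, dA (i, j) * dA (k, l) = dA (i, l) * dA (k, j) :=
    fun i k j l => hc i k j l (by omega) (by omega) (by omega) (by omega)
  set χ : ℂ := (∏ i : Fin 3, dA (i, 0) / dA (0, 0)) * ∏ j : Fin 3, dA (0, j) with hχ
  refine kLimit_linSubst_stable_of_semiInvariant isBorderApolarLimit_diag _
    (Matrix.isUnits_det_units A) (fun _ => χ) fun t => ?_
  rw [Pdiag_eq t, hMdiag, ← AlgHom.comp_apply, ← linSubst_mul, Matrix.diagonal_mul_diagonal]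
  have hcomm : (Matrix.diagonal fun i : Fin 3 × Fin 3 => dA i * ((t : ℂ) + 2) ^ wDiag i) =
      (Matrix.diagonal fun i : Fin 3 × Fin 3 => ((t : ℂ) + 2) ^ wDiag i) * Matrix.diagonal dA := by
    rw [Matrix.diagonal_mul_diagonal]
    congr 1
    funext i
    ring
  rw [hcomm, linSubst_mul, AlgHom.comp_apply, linSubst_diagonal_detPoly dA hrel (hd0 _), map_smul]

/-- (GEN) `∂^e ∈ Jdiag 3` for every degree-3 exponent `e ≠ e_id`. -/
theorem monomial_mem_Jdiag_three (e : (Fin 3 × Fin 3) →₀ ℕ) (he : e.degree = 3) (hne : e ≠ eId) :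
    (monomial e (1 : ℂ)) ∈ Jdiag 3 :=
  mem_Jdiag_iff.2 (monomial_mem_inSpan_three e he hne)

/-- (BDRY) **`Jdiag` is not an interior point**: for no `g ∈ GL_9` is `Jdiag` the border-apolar limit of
the constant sequence `g · det_3`.  Otherwise `Ann_3(g·det_3) ⊇ {∂^e : e ≠ e_id}` (closedness of a
finite-dimensional annihilator), so `g·det_3 ∝ x₀₀x₁₁x₂₂`, whose degree-1 annihilator contains `∂₀₁`,
contradicting `dim Ann_1(g·det_3) = 9 - 9 = 0` (`stub_annSubmodule`). [folklore] -/
theorem Jdiag_not_interior (g : Matrix.GeneralLinearGroup (Fin 3 × Fin 3) ℂ) :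
    ¬ IsBorderApolarLimit 3
      (fun _ : ℕ => linSubst (Fin 3 × Fin 3) ℂ (g : Matrix (Fin 3 × Fin 3) (Fin 3 × Fin 3) ℂ) (detPoly (Fin 3) ℂ))
      Jdiag := by
  classical
  intro hI
  set F : MvPolynomial (Fin 3 × Fin 3) ℂ :=
    linSubst (Fin 3 × Fin 3) ℂ (g : Matrix (Fin 3 × Fin 3) (Fin 3 × Fin 3) ℂ) (detPoly (Fin 3) ℂ) with hF
  have hForb : F ∈ glOrbit (Fin 3 × Fin 3) ℂ (detPoly (Fin 3) ℂ) := ⟨g, rfl⟩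
  have hFhom : F.IsHomogeneous 3 := linSubst_isHomogeneous _ detPoly_three_isHomogeneous
  haveI hfin : ∀ k, Module.Finite ℂ (homogeneousSubmodule (Fin 3 × Fin 3) ℂ k) := fun k =>
    Module.Finite.iff_fg.2 (homogeneousSubmodule_fg _ _ k)
  -- every `∂^e`, `e ≠ e_id` of degree 3, annihilates `F`
  have hcoeff : ∀ e : (Fin 3 × Fin 3) →₀ ℕ, e.degree = 3 → e ≠ eId → coeff e F = 0 := by
    intro e he hne
    obtain ⟨Ds, hDs, hDlim⟩ := hI.1 3 le_rfl _ (monomial_mem_Jdiag_three e he hne)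
    obtain ⟨A3, hA3, hA3le, -⟩ := exists_annSubmodule 3 F
    haveI : FiniteDimensional ℂ A3 := Submodule.finiteDimensional_of_le hA3le
    have hmemA : monomial e (1 : ℂ) ∈ A3 :=
      ca_mem_of_tendsto_coeffVec A3 (fun t => by
        rw [← SetLike.mem_coe, hA3, mem_annihilatorOfDegree_iff]; exact hDs t) hDlim
    rw [← SetLike.mem_coe, hA3, mem_annihilatorOfDegree_iff] at hmemA
    have h2 := hmemA.2
    rw [apolarAction_eq_C (isHomogeneous_monomial (1 : ℂ) he) hFhom, support_monomial,
      if_neg one_ne_zero, Finset.sum_singleton, coeff_monomial, if_pos rfl, one_mul, ← C_0] at h2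
    have h3 := mul_eq_zero.1 (C_injective _ _ h2)
    exact h3.resolve_right (prod_factorial_ne_zero e)
  -- hence `F = F_{e_id} · x₀₀x₁₁x₂₂`
  have hFeq : F = monomial eId (coeff eId F) := by
    ext d
    rw [coeff_monomial]
    by_cases hd : eId = d
    · rw [if_pos hd, hd]
    · rw [if_neg hd]
      by_cases hdeg : d.degree = 3
      · exact hcoeff d hdeg (Ne.symm hd)
      · exact hFhom.coeff_eq_zero hdeg
  -- so `∂₀₁ ∈ Ann_1(F)`, while `dim Ann_1(F) = 0`
  have hX : (X (0, 1) : MvPolynomial (Fin 3 × Fin 3) ℂ) ∈ annihilatorOfDegree F 1 := by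
    rw [mem_annihilatorOfDegree_iff]
    refine ⟨isHomogeneous_X ℂ (0, 1), ?_⟩
    rw [apolarAction_X, hFeq, pderiv_monomial]
    have h0 : eId ((0 : Fin 3), (1 : Fin 3)) = 0 := by
      rw [eId, permMonomial_apply]; decide
    rw [h0, Nat.cast_zero, mul_zero, monomial_zero]
  obtain ⟨A1, hA1, hA1le, hA1dim⟩ := stub_annSubmodule 3 1 F hForb
  haveI : FiniteDimensional ℂ A1 := Submodule.finiteDimensional_of_le hA1le
  have hdim0 : Module.finrank ℂ A1 = 0 := by rw [hA1dim]; decide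
  have hbot : A1 = ⊥ := Submodule.finrank_eq_zero.1 hdim0
  have hXA : (X (0, 1) : MvPolynomial (Fin 3 × Fin 3) ℂ) ∈ A1 := by
    rw [← SetLike.mem_coe, hA1]; exact hX
  rw [hbot, Submodule.mem_bot] at hXA
  exact X_ne_zero _ hXA

/-- **`¬ ToricFixedPointsInterior`.**  The `H₀(3,3)`-fixed Kuratowski limit `Jdiag` of the toric curve
`diag((t+2)^{wDiag}) · det_3` (limit form `x₀₀x₁₁x₂₂`) satisfies every hypothesis of the crux
(`Pdiag_mem_glOrbit`, `isBorderApolarLimit_diag`, `Jdiag_h0Stable`) but is not an interior point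
(`Jdiag_not_interior`): BOUNDARY fixed points of `Z_det` exist, so the translate-and-degenerate shape
(`w ≠ 0`) of the crux's conclusion is essential. [folklore] -/
theorem toricFixedPointsInterior_false : ¬ ToricFixedPointsInterior := by
  intro h
  have h33 := @h 3 3 inferInstance le_rfl le_rfl
  dsimp only at h33
  obtain ⟨g, hLi', hLs'⟩ := h33 Pdiag Jdiag Pdiag_mem_glOrbit isBorderApolarLimit_diag Jdiag_h0Stable
  exact Jdiag_not_interior g ⟨hLi', hLs'⟩


end Summit.ValiantsHypothesis.ValiantsHypothesis.Cruxes.ToricFixedPoints.Disproof
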